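import Summits.HubbardSuperconductivity.HubbardSuperconductivity.Theorems.ThermalWedgeTwSeededEnsembleEquivalenceRColdAssembly
import Summits.HubbardSuperconductivity.HubbardSuperconductivity.Theorems.ThermalWedgeTwSeededEnsembleEquivalenceRColdEdgeGlue
import Summits.HubbardSuperconductivity.HubbardSuperconductivity.Theorems.ThermalWedgeTwSeededEnsembleEquivalenceRSourcedPressureLimit
import Summits.HubbardSuperconductivity.HubbardSuperconductivity.Theorems.ThermalWedgeTwSeededEnsembleEquivalenceRFreePairEnergyBandBottom
import Summits.HubbardSuperconductivity.HubbardSuperconductivity.Theorems.ThermalWedgeTwSeededEnsembleEquivalenceRFreeDensityBandBottom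
import Summits.HubbardSuperconductivity.HubbardSuperconductivity.Theorems.ThermalWedgeTwSeededEnsembleEquivalenceRFreeDensityNearHalfFilling
import Summits.HubbardSuperconductivity.HubbardSuperconductivity.Theorems.ThermalWedgeTwSeededEnsembleEquivalenceRFreeColdDiffCalibration
import Summits.HubbardSuperconductivity.HubbardSuperconductivity.Theorems.ThermalWedgeTwSeededEnsembleEquivalenceRFreeColdUniqCalibration

/-!
# Crux `TwSeededEnsembleEquivalenceR` (stmt-HubbardSuperconductivity-15581), line `cold-floor-collapse`
# (slug `Sketch`), lead c5 — the FREE (`U = 0`) cold regularity of the sourced limit pressure at EVERY `β ≥ 20000`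

Support file (`--supports stmt-HubbardSuperconductivity-15581`; sorry-free; no definition; route-file free).

The `U = 0` corner of the line's physics stub S4, at every inverse temperature `β ≥ 20000` (not only the cold
slice `β = e^{a/U}`): for the pointwise thermodynamic limit `q(μ,h)` of the FREE `d`-wave-sourced torus pressure
`log Re Z(β, dWaveSourceTorus L 0 μ h)/(βL²)` (which IS the explicit Brillouin-zone integral,
`cfl_freeSourcedPressure_limit`), on the window `[−399/100, −1/400000]` and the source box `|h| ≤ 13g+1`,
`g ∈ (0, 1/10]`:
* (DIFF/UNIQ′, free) at every `μ` all maximisers `h*` of `h ↦ q(μ,h) − h²/g` share ONE `μ`-slope `d`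
  (`cal_freeColdUniq`: maximisers are `±h*`; `cal_freeColdDiff`: `∂_μ q₀ =` the BdG density, even in `h`);
* (EDGE) `d(μm) ≤ 1 − δ ≤ d(μp)` at `μm = −79/20`, `μp = −1/200000` — G″'s localisation argument
  (`sourcedColdRegularity_of_freeFacts`) verbatim with `U = 0`: F1 `stub_freePairEnergyBandBottom` + optimality pin
  `|h*| ≤ 10⁻³` at the low edge, F2 `stub_freeDensityBandBottom` (`β ≥ 200`) and F3 `stub_freeDensityNearHalfFilling`
  (`β ≥ 20000`) bound the free density increments (`cfl_q0_increment_bracket`), `μ`-convexity turns them into slopes.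

This is the conclusion shape of S4 consumed by the cold assembly S5, here feeding the `U = 0` seeded ensemble
equivalence at all `β ≥ 20000` (…RHotWindow.lean). Registered form: `hw_freeSeededRegularity`. [folklore composition]
-/

set_option linter.dupNamespace false

namespace Summit.HubbardSuperconductivity.HubbardSuperconductivity.Theorems.TwSeededEnsembleEquivalenceR.HotWindow

open Matrix Filter Topology Finset Literature.MathematicalPhysics.QuantumLattice
open Summit.HubbardSuperconductivity.HubbardSuperconductivity.Theorems.TwSeededEnsembleEquivalence.ThermalDuality
open Summit.HubbardSuperconductivity.HubbardSuperconductivity.Theorems.TwSeededEnsembleEquivalenceR.ColdFloorLine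
open scoped ComplexOrder
open Real MeasureTheory intervalIntegral

noncomputable section

/-- **Free cold regularity at every `β ≥ 20000` (the `U = 0` corner of S4).** For `δ ∈ [1/10, 2/5]`, `β ≥ 20000`,
`g ∈ (0, 1/10]` and the (global) pointwise limit `q` of the free sourced torus pressure at `β`: on the window
`(−399/100, −1/400000)` every maximiser of `h ↦ q(μ,h) − h²/g` over `|h| ≤ 13g+1` has a common `μ`-slope, and the
slopes at `μm = −79/20`, `μp = −1/200000` bracket `1 − δ`. [folklore composition] -/
theorem freeSeededRegularity (δ β g : ℝ) (hδ : δ ∈ Set.Icc (1/10 : ℝ) (2/5 : ℝ)) (hβB : 20000 ≤ β)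
    (hg : g ∈ Set.Ioc (0 : ℝ) (1 / 10)) (q : ℝ → ℝ → ℝ)
    (hq : ∀ μ h : ℝ, ∀ κ : ℝ, 0 < κ → ∃ L₀ : ℕ, ∀ (L : ℕ) [NeZero L], L₀ ≤ L →
      |Real.log (Matrix.partitionFn β (dWaveSourceTorus L 0 μ h)).re / (β * (L : ℝ) ^ 2) - q μ h| ≤ κ) :
    (∀ μ ∈ Set.Ioo (-(399 / 100) : ℝ) (-(1 / 400000)), ∃ d : ℝ, ∀ h ∈ Set.Icc (-(13 * g + 1)) (13 * g + 1),
        q μ h - h ^ 2 / g = sSup ((fun h' : ℝ => q μ h' - h' ^ 2 / g) '' Set.Icc (-(13 * g + 1)) (13 * g + 1)) →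
          HasDerivAt (fun μ' => q μ' h) d μ) ∧
    (∃ μm ∈ Set.Ioo (-(399 / 100) : ℝ) (-(1 / 400000)), ∃ μp ∈ Set.Ioo (-(399 / 100) : ℝ) (-(1 / 400000)), ∃ dm dp : ℝ,
        dm ≤ 1 - δ ∧ 1 - δ ≤ dp ∧
        (∀ h ∈ Set.Icc (-(13 * g + 1)) (13 * g + 1),
          q μm h - h ^ 2 / g = sSup ((fun h' : ℝ => q μm h' - h' ^ 2 / g) '' Set.Icc (-(13 * g + 1)) (13 * g + 1)) →
            HasDerivAt (fun μ' => q μ' h) dm μm) ∧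
        (∀ h ∈ Set.Icc (-(13 * g + 1)) (13 * g + 1),
          q μp h - h ^ 2 / g = sSup ((fun h' : ℝ => q μp h' - h' ^ 2 / g) '' Set.Icc (-(13 * g + 1)) (13 * g + 1)) →
            HasDerivAt (fun μ' => q μ' h) dp μp)) := by
  obtain ⟨hg0, hg1⟩ := hg
  have hβ : 0 < β := by linarith
  have hβ200 : 200 ≤ β := by linarith
  have hg10 : 10 ≤ 1 / g := by
    rw [le_div_iff₀ hg0]
    linarith
  set H : ℝ := 13 * g + 1 with hHdef
  have hH : 0 ≤ H := by positivity
  have h0S : (0 : ℝ) ∈ Set.Icc (-H) H := ⟨by linarith, hH⟩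
  -- sequences `n ↦ p̃_{n+1}` for the inheritance lemmas
  have hseq : ∀ μ h : ℝ, ∀ κ : ℝ, 0 < κ → ∃ N : ℕ, ∀ n, N ≤ n →
      |Real.log (partitionFn β (dWaveSourceTorus (n + 1) 0 μ h)).re / (β * (((n + 1 : ℕ) : ℝ)) ^ 2) -
        q μ h| ≤ κ := by
    intro μ h κ hκ
    obtain ⟨L₀, hL₀⟩ := hq μ h κ hκ
    exact ⟨L₀, fun n hn => hL₀ (n + 1) (by omega)⟩
  -- the free limit IS the explicit Brillouin-zone integral (uniqueness of limits)
  have hseqI : ∀ μ h : ℝ, ∀ κ : ℝ, 0 < κ → ∃ N : ℕ, ∀ n, N ≤ n →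
      |Real.log (partitionFn β (dWaveSourceTorus (n + 1) 0 μ h)).re / (β * (((n + 1 : ℕ) : ℝ)) ^ 2) -
        (∫ θ₁ in (0 : ℝ)..2 * π, ∫ θ₂ in (0 : ℝ)..2 * π, (2 * Real.log 2 / β - (-2 * (Real.cos θ₁ + Real.cos θ₂) - μ) + 1 / β * Real.log ((1 + Real.cosh (β * Real.sqrt ((-2 * (Real.cos θ₁ + Real.cos θ₂) - μ) ^ 2 + (2 * Real.sqrt 2 * h * (Real.cos θ₁ - Real.cos θ₂)) ^ 2))) / 2))) / (4 * π ^ 2)| ≤ κ := by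
    intro μ h κ hκ
    obtain ⟨L₀, hL₀⟩ := cfl_freeSourcedPressure_limit β μ h hβ κ hκ
    exact ⟨L₀, fun n hn => hL₀ (n + 1) (by omega)⟩
  have hqI : ∀ μ h : ℝ, q μ h = (∫ θ₁ in (0 : ℝ)..2 * π, ∫ θ₂ in (0 : ℝ)..2 * π, (2 * Real.log 2 / β - (-2 * (Real.cos θ₁ + Real.cos θ₂) - μ) + 1 / β * Real.log ((1 + Real.cosh (β * Real.sqrt ((-2 * (Real.cos θ₁ + Real.cos θ₂) - μ) ^ 2 + (2 * Real.sqrt 2 * h * (Real.cos θ₁ - Real.cos θ₂)) ^ 2))) / 2))) / (4 * π ^ 2) := fun μ h =>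
    le_antisymm (cfb_le_of_limits (hseq μ h) (hseqI μ h) fun n => le_rfl)
      (cfb_le_of_limits (hseqI μ h) (hseq μ h) fun n => le_rfl)
  -- `h`-Lipschitz bound and `μ`-convexity of the limit
  have hLh : ∀ (μ : ℝ), ∀ h ∈ Set.Icc (-H) H, ∀ h' ∈ Set.Icc (-H) H,
      |q μ h - q μ h'| ≤ 8 * Real.sqrt 2 * |h - h'| := by
    intro μ h _ h' _
    refine cfb_abs_sub_le_of_limits (hseq μ h) (hseq μ h') fun n => ?_
    have := abs_sourcedPressure_sub_le (n + 1) 0 μ hβ h h'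
    simpa using this
  have hconv : ∀ h : ℝ, ConvexOn ℝ Set.univ (fun μ => q μ h) := by
    intro h
    refine cfb_convexOn_univ_of_limit (f := fun n μ =>
      Real.log (partitionFn β (dWaveSourceTorus (n + 1) 0 μ h)).re / (β * (((n + 1 : ℕ) : ℝ)) ^ 2))
      (fun n => ?_) (fun μ κ hκ => hseq μ h κ hκ)
    have := cfb_convexOn_sourcedPressure (n + 1) 0 h hβ
    simpa using this
  -- (DIFF, free): the `μ`-derivative of the limit is the explicit BdG density
  have hD : ∀ μ h : ℝ, HasDerivAt (fun μ' => q μ' h) ((∫ θ₁ in (0 : ℝ)..2 * π, ∫ θ₂ in (0 : ℝ)..2 * π, (1 - (if (-2 * (Real.cos θ₁ + Real.cos θ₂) - μ) ^ 2 + (2 * Real.sqrt 2 * h * (Real.cos θ₁ - Real.cos θ₂)) ^ 2 = 0 then (0:ℝ) else (-2 * (Real.cos θ₁ + Real.cos θ₂) - μ) / Real.sqrt ((-2 * (Real.cos θ₁ + Real.cos θ₂) - μ) ^ 2 + (2 * Real.sqrt 2 * h * (Real.cos θ₁ - Real.cos θ₂)) ^ 2) * Real.tanh (β * Real.sqrt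 ((-2 * (Real.cos θ₁ + Real.cos θ₂) - μ) ^ 2 + (2 * Real.sqrt 2 * h * (Real.cos θ₁ - Real.cos θ₂)) ^ 2) / 2)))) / (4 * π ^ 2)) μ := by
    intro μ h
    have e : (fun μ' => q μ' h) = (fun μ' : ℝ => ((∫ θ₁ in (0 : ℝ)..2 * π, ∫ θ₂ in (0 : ℝ)..2 * π, (2 * Real.log 2 / β - (-2 * (Real.cos θ₁ + Real.cos θ₂) - μ') + 1 / β * Real.log ((1 + Real.cosh (β * Real.sqrt ((-2 * (Real.cos θ₁ + Real.cos θ₂) - μ') ^ 2 + (2 * Real.sqrt 2 * h * (Real.cos θ₁ - Real.cos θ₂)) ^ 2))) / 2))) / (4 * π ^ 2))) := funext fun μ' => hqI μ' h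
    rw [e]
    exact cal_freeColdDiff β μ h hβ
  -- the BdG density is even in the source
  have hNeven : ∀ μ h : ℝ, ((∫ θ₁ in (0 : ℝ)..2 * π, ∫ θ₂ in (0 : ℝ)..2 * π, (1 - (if (-2 * (Real.cos θ₁ + Real.cos θ₂) - μ) ^ 2 + (2 * Real.sqrt 2 * (-h) * (Real.cos θ₁ - Real.cos θ₂)) ^ 2 = 0 then (0:ℝ) else (-2 * (Real.cos θ₁ + Real.cos θ₂) - μ) / Real.sqrt ((-2 * (Real.cos θ₁ + Real.cos θ₂) - μ) ^ 2 + (2 * Real.sqrt 2 * (-h) * (Real.cos θ₁ - Real.cos θ₂)) ^ 2) * Real.tanh (β * Real.sqrt ((-2 * (Real.cos θ₁ + Real.cos θ₂) - μ) ^ 2 + (2 * Real.sqrt 2 * (-h) * (Real.cos θ₁ - Real.cos θ₂)) ^ 2) / 2)))) / (4 * π ^ 2)) = ((∫ θ₁ in (0 : ℝ)..2 * π, ∫ θ₂ in (0 : ℝ)..2 * π, (1 - (if (-2 * (Real.cos θ₁ + Real.cos θ₂) - μ) ^ 2 + (2 * Real.sqrt 2 * h * (Real.cos θ₁ - Real.cos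 θ₂)) ^ 2 = 0 then (0:ℝ) else (-2 * (Real.cos θ₁ + Real.cos θ₂) - μ) / Real.sqrt ((-2 * (Real.cos θ₁ + Real.cos θ₂) - μ) ^ 2 + (2 * Real.sqrt 2 * h * (Real.cos θ₁ - Real.cos θ₂)) ^ 2) * Real.tanh (β * Real.sqrt ((-2 * (Real.cos θ₁ + Real.cos θ₂) - μ) ^ 2 + (2 * Real.sqrt 2 * h * (Real.cos θ₁ - Real.cos θ₂)) ^ 2) / 2)))) / (4 * π ^ 2)) := by
    intro μ h
    simp only [mul_neg, neg_mul, neg_sq]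
  -- (UNIQ′, free) ⟹ one common slope at all maximisers
  have hDU : ∀ μ : ℝ, ∃ d : ℝ, ∀ h ∈ Set.Icc (-H) H,
      q μ h - h ^ 2 / g = sSup ((fun h' : ℝ => q μ h' - h' ^ 2 / g) '' Set.Icc (-H) H) →
        HasDerivAt (fun μ' => q μ' h) d μ := by
    intro μ
    obtain ⟨hstar, huniq⟩ := cal_freeColdUniq β μ g H hβ hg0 hH
    refine ⟨((∫ θ₁ in (0 : ℝ)..2 * π, ∫ θ₂ in (0 : ℝ)..2 * π, (1 - (if (-2 * (Real.cos θ₁ + Real.cos θ₂) - μ) ^ 2 + (2 * Real.sqrt 2 * hstar * (Real.cos θ₁ - Real.cos θ₂)) ^ 2 = 0 then (0:ℝ) else (-2 * (Real.cos θ₁ + Real.cos θ₂) - μ) / Real.sqrt ((-2 * (Real.cos θ₁ + Real.cos θ₂) - μ) ^ 2 + (2 * Real.sqrt 2 * hstar * (Real.cos θ₁ - Real.cos θ₂)) ^ 2) * Real.tanh (β * Real.sqrt ((-2 * (Real.cos θ₁ + Real.cos θ₂) - μ) ^ 2 + (2 * Real.sqrt 2 * hstar * (Real.cos θ₁ - Real.cos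 θ₂)) ^ 2) / 2)))) / (4 * π ^ 2)), fun h hh hmax => ?_⟩
    have e : (fun h' : ℝ => q μ h' - h' ^ 2 / g) = (fun h' : ℝ => (∫ θ₁ in (0 : ℝ)..2 * π, ∫ θ₂ in (0 : ℝ)..2 * π, (2 * Real.log 2 / β - (-2 * (Real.cos θ₁ + Real.cos θ₂) - μ) + 1 / β * Real.log ((1 + Real.cosh (β * Real.sqrt ((-2 * (Real.cos θ₁ + Real.cos θ₂) - μ) ^ 2 + (2 * Real.sqrt 2 * h' * (Real.cos θ₁ - Real.cos θ₂)) ^ 2))) / 2))) / (4 * π ^ 2) - h' ^ 2 / g) :=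
      funext fun h' => by rw [hqI]
    rw [e, hqI] at hmax
    rcases huniq h hh hmax with rfl | rfl
    · exact hD μ _
    · have h1 := hD μ (-hstar)
      rw [hNeven μ hstar] at h1
      exact h1
  refine ⟨fun μ _ => hDU μ, -(79 / 20), ⟨by norm_num, by norm_num⟩, -(1 / 200000), ⟨by norm_num, by norm_num⟩, ?_⟩
  obtain ⟨dm, hdm⟩ := hDU (-(79 / 20))
  obtain ⟨dp, hdp⟩ := hDU (-(1 / 200000))
  refine ⟨dm, dp, ?_, ?_, hdm, hdp⟩
  · -- LOW EDGE at `μm = −79/20`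
    obtain ⟨hs, hsS, hmax, hsup⟩ := danskin_exists_max q g hH hLh (-(79 / 20))
    -- (i) localisation of the optimal source: |hs| ≤ 10⁻³
    have hopt : q (-(79 / 20)) 0 - 0 ^ 2 / g ≤ q (-(79 / 20)) hs - hs ^ 2 / g := hmax 0 h0S
    have hopt' : hs ^ 2 / g ≤ q (-(79 / 20)) hs - q (-(79 / 20)) 0 := by
      have e0 : (0 : ℝ) ^ 2 / g = 0 := by simp
      linarith
    have hF1' : q (-(79 / 20)) hs - q (-(79 / 20)) 0 ≤ 4 * hs ^ 2 + Real.sqrt 2 / 400 * |hs| := by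
      rw [hqI, hqI]
      exact stub_freePairEnergyBandBottom β hs hβ
    have hsq : 10 * hs ^ 2 ≤ hs ^ 2 / g := by
      calc 10 * hs ^ 2 = hs ^ 2 * 10 := by ring
        _ ≤ hs ^ 2 * (1 / g) := mul_le_mul_of_nonneg_left hg10 (sq_nonneg _)
        _ = hs ^ 2 / g := by ring
    have hloc : 6 * hs ^ 2 ≤ Real.sqrt 2 / 400 * |hs| := by linarith
    have hs2 : Real.sqrt 2 ≤ 3 / 2 := by
      rw [show (3 / 2 : ℝ) = Real.sqrt ((3 / 2) ^ 2) by rw [Real.sqrt_sq (by norm_num)]]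
      exact Real.sqrt_le_sqrt (by norm_num)
    have hsmall : |hs| ≤ 1 / 1000 := by
      by_contra hcon
      rw [not_le] at hcon
      have habs : 0 ≤ |hs| := abs_nonneg hs
      have hsqa : hs ^ 2 = |hs| ^ 2 := (sq_abs hs).symm
      have hprod : 0 ≤ 6 * |hs| * (|hs| - 1 / 1000) := by
        have : 0 ≤ |hs| - 1 / 1000 := by linarith
        positivity
      nlinarith [hloc, hcon, hs2, hsqa, habs, hprod]
    -- (ii) slope ≤ right secant ≤ free increment / step ≤ 1/10 ≤ 1 − δ
    have hsup' : q (-(79 / 20)) hs - hs ^ 2 / g =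
        sSup ((fun h' : ℝ => q (-(79 / 20)) h' - h' ^ 2 / g) '' Set.Icc (-H) H) := hsup.symm
    have hDm : HasDerivAt (fun μ' => q μ' hs) dm (-(79 / 20)) := hdm hs hsS hsup'
    have hsl := (hconv hs).le_slope_of_hasDerivAt (Set.mem_univ (-(79 / 20) : ℝ))
      (Set.mem_univ (-(79 / 20) + 1 / 100 : ℝ)) (by norm_num) hDm
    rw [slope_def_field] at hsl
    have hden : (-(79 / 20) + 1 / 100 - -(79 / 20) : ℝ) = 1 / 100 := by norm_num
    rw [hden, le_div_iff₀ (by norm_num : (0 : ℝ) < 1 / 100)] at hsl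
    have hbr := (cfl_q0_increment_bracket β hs hβ (fun μ => q μ hs) (fun μ _ κ hκ => hq μ hs κ hκ)
      (μ₁ := -(79 / 20) + 1 / 100) (μ₂ := -(79 / 20)) ⟨by norm_num, by norm_num⟩
      ⟨by norm_num, by norm_num⟩ (by norm_num)).2
    have hN := stub_freeDensityBandBottom β hs (-(79 / 20) + 1 / 100) hβ200 hsmall ⟨by norm_num, by norm_num⟩
    have hinc : q (-(79 / 20) + 1 / 100) hs - q (-(79 / 20)) hs ≤ 1 / 100 * (1 / 10) := by
      have e : (-(79 / 20) + 1 / 100 - -(79 / 20) : ℝ) = 1 / 100 := by ring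
      rw [e] at hbr
      exact hbr.trans (mul_le_mul_of_nonneg_left hN (by norm_num))
    linarith [hδ.2]
  · -- HIGH EDGE at `μp = −1/200000`: slope ≥ left secant ≥ free increment / step ≥ 19/20 ≥ 1 − δ
    obtain ⟨hs, hsS, -, hsup⟩ := danskin_exists_max q g hH hLh (-(1 / 200000))
    have hsup' : q (-(1 / 200000)) hs - hs ^ 2 / g =
        sSup ((fun h' : ℝ => q (-(1 / 200000)) h' - h' ^ 2 / g) '' Set.Icc (-H) H) := hsup.symm
    have hDp : HasDerivAt (fun μ' => q μ' hs) dp (-(1 / 200000)) := hdp hs hsS hsup'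
    have hsl := (hconv hs).slope_le_of_hasDerivAt (Set.mem_univ (-(1 / 100000) : ℝ))
      (Set.mem_univ (-(1 / 200000) : ℝ)) (by norm_num) hDp
    rw [slope_def_field] at hsl
    have hden : (-(1 / 200000) - -(1 / 100000) : ℝ) = 1 / 200000 := by norm_num
    rw [hden, div_le_iff₀ (by norm_num : (0 : ℝ) < 1 / 200000)] at hsl
    have hbr := (cfl_q0_increment_bracket β hs hβ (fun μ => q μ hs) (fun μ _ κ hκ => hq μ hs κ hκ)
      (μ₁ := -(1 / 200000)) (μ₂ := -(1 / 100000)) ⟨by norm_num, by norm_num⟩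
      ⟨by norm_num, by norm_num⟩ (by norm_num)).1
    have hN := stub_freeDensityNearHalfFilling β hs (-(1 / 100000)) hβB ⟨by norm_num, by norm_num⟩
    have hinc : 1 / 200000 * (19 / 20 : ℝ) ≤ q (-(1 / 200000)) hs - q (-(1 / 100000)) hs := by
      have e : (-(1 / 200000) - -(1 / 100000) : ℝ) = 1 / 200000 := by ring
      rw [e] at hbr
      exact le_trans (mul_le_mul_of_nonneg_left hN (by norm_num)) hbr
    linarith [hδ.1]

/-! ### Registered form -/

/-- **Registered stub `hw_freeSeededRegularity` (line `Sketch`, crux stmt-HubbardSuperconductivity-15581): the free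
cold regularity at every `β ≥ 20000`, binder-free and fully qualified** (= `freeSeededRegularity`). [folklore] -/
theorem hw_freeSeededRegularity : ∀ (δ β g : ℝ), δ ∈ Set.Icc (1/10 : ℝ) (2/5 : ℝ) → 20000 ≤ β → g ∈ Set.Ioc (0 : ℝ) (1 / 10) → ∀ q : ℝ → ℝ → ℝ, (∀ μ h : ℝ, ∀ κ : ℝ, 0 < κ → ∃ L₀ : ℕ, ∀ (L : ℕ) [NeZero L], L₀ ≤ L → |Real.log (Matrix.partitionFn β (Literature.MathematicalPhysics.QuantumLattice.dWaveSourceTorus L 0 μ h)).re / (β * (L : ℝ) ^ 2) - q μ h| ≤ κ) → (∀ μ ∈ Set.Ioo (-(399 / 100) : ℝ) (-(1 / 400000)), ∃ d : ℝ, ∀ h ∈ Set.Icc (-(13 * g + 1)) (13 * g + 1), q μ h - h ^ 2 / g = sSup ((fun h' : ℝ => q μ h' - h' ^ 2 / g) '' Set.Icc (-(13 * g + 1)) (13 * g + 1)) → HasDerivAt (fun μ' => q μ' h) d μ) ∧ (∃ μm ∈ Set.Ioo (-(399 / 100) : ℝ) (-(1 / 400000)), ∃ μp ∈ Set.Ioo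 (-(399 / 100) : ℝ) (-(1 / 400000)), ∃ dm dp : ℝ, dm ≤ 1 - δ ∧ 1 - δ ≤ dp ∧ (∀ h ∈ Set.Icc (-(13 * g + 1)) (13 * g + 1), q μm h - h ^ 2 / g = sSup ((fun h' : ℝ => q μm h' - h' ^ 2 / g) '' Set.Icc (-(13 * g + 1)) (13 * g + 1)) → HasDerivAt (fun μ' => q μ' h) dm μm) ∧ (∀ h ∈ Set.Icc (-(13 * g + 1)) (13 * g + 1), q μp h - h ^ 2 / g = sSup ((fun h' : ℝ => q μp h' - h' ^ 2 / g) '' Set.Icc (-(13 * g + 1)) (13 * g + 1)) → HasDerivAt (fun μ' => q μ' h) dp μp)) :=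
  fun δ β g hδ hβB hg q hq => freeSeededRegularity δ β g hδ hβB hg q hq

end

end Summit.HubbardSuperconductivity.HubbardSuperconductivity.Theorems.TwSeededEnsembleEquivalenceR.HotWindow
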